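import Summits.Ventures.PercRepro.Defs

/-!
# The static decision-tree swap (Gladkov–Zimin, Lemma 4.2, finite form)

For two configurations `ω, ω'` and an edge set `S`, `mix S ω ω'` is the configuration equal to
`ω` on `S` and to `ω'` off `S` (GZ24's `C₁ →_S C₂`, arXiv:2404.08873, Definition 4.1).  When the
edge set `S = S ω ω'` is chosen from the pair in a *recoverable* way — some function `R`
returns `S ω ω'` from the swapped pair `(mix (S ω ω')ᶜ ω ω', mix (S ω ω') ω ω')` (this is what a
decision tree guarantees: the queries that built `S` are answered identically by the swapped
pair, `DecisionTree.lean`) — the swap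
`Φ (ω, ω') = (mix (S ω ω')ᶜ ω ω', mix (S ω ω') ω ω')`
is a bijection of `Config E × Config E` preserving the product weight
(`weight_mix_compl_mul_weight_mix`, `swapPair_bijective`).  Consequently the swapped pair is again
a pair of independent percolation configurations:
`∑ ω ω', w(ω) w(ω') F(Φ₁, Φ₂) = ∑ ω ω', w(ω) w(ω') F(ω, ω')` (`sum_swapPair`), in particular
`P(Φ₁ ∈ X ∧ Φ₂ ∈ Y) = P(X) P(Y)` (`prob_mul_prob_eq_sum_swap`) and `P(Φ₂ ∈ Y) = P(Y)`
(`sum_indicator_mix_eq_prob`).  This is the tool behind GZ24's inequality (final)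
(`Summits.Ventures.PercRepro.GZ24Final`); no decision trees are formalised, only their static
output.
-/

namespace PercRepro

open Finset

section Mix

variable {E : Type*}

open Classical in
/-- `mix S ω ω'` (GZ24's `ω →_S ω'`): the configuration that agrees with `ω` on `S` and with `ω'`
off `S`. -/
noncomputable def mix (S : Set E) (ω ω' : Config E) : Config E :=
  fun e => if e ∈ S then ω e else ω' e

/-- On `S`, `mix S ω ω'` is `ω`. -/
theorem mix_apply_of_mem {S : Set E} {e : E} (he : e ∈ S) (ω ω' : Config E) :
    mix S ω ω' e = ω e := by
  simp [mix, he]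

/-- Off `S`, `mix S ω ω'` is `ω'`. -/
theorem mix_apply_of_notMem {S : Set E} {e : E} (he : e ∉ S) (ω ω' : Config E) :
    mix S ω ω' e = ω' e := by
  simp [mix, he]

/-- On `S`, `mix Sᶜ ω ω'` is `ω'`. -/
theorem mix_compl_apply_of_mem {S : Set E} {e : E} (he : e ∈ S) (ω ω' : Config E) :
    mix Sᶜ ω ω' e = ω' e := by
  simp [mix, he]

/-- Off `S`, `mix Sᶜ ω ω'` is `ω`. -/
theorem mix_compl_apply_of_notMem {S : Set E} {e : E} (he : e ∉ S) (ω ω' : Config E) :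
    mix Sᶜ ω ω' e = ω e := by
  simp [mix, he]

/-- The two swapped configurations carry the product weight of the original pair: edge by edge,
the pair `(ω e, ω' e)` is replaced by `(ω' e, ω e)` on `S` and kept off `S`. -/
theorem weight_mix_compl_mul_weight_mix [Fintype E] (p : E → ℝ) (S : Set E) (ω ω' : Config E) :
    weight p (mix Sᶜ ω ω') * weight p (mix S ω ω') = weight p ω * weight p ω' := by
  unfold weight
  rw [← Finset.prod_mul_distrib, ← Finset.prod_mul_distrib]
  refine Finset.prod_congr rfl fun e _ => ?_
  by_cases he : e ∈ S
  · rw [mix_compl_apply_of_mem he, mix_apply_of_mem he, mul_comm]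
  · rw [mix_compl_apply_of_notMem he, mix_apply_of_notMem he]

/-- The swap of a pair of configurations along the edge set `S ω ω'` chosen from the pair:
`Φ (ω, ω') = (ω →_{(S ω ω')ᶜ} ω', ω →_{S ω ω'} ω')`. -/
noncomputable def swapPair (S : Config E → Config E → Set E) (x : Config E × Config E) :
    Config E × Config E :=
  (mix (S x.1 x.2)ᶜ x.1 x.2, mix (S x.1 x.2) x.1 x.2)

/-- `Recoverable S`: the edge set `S ω ω'` can be read off the swapped pair (the static content
of a decision tree: the queries that built `S ω ω'` are answered the same way by `Φ (ω, ω')`). -/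
def Recoverable (S : Config E → Config E → Set E) : Prop :=
  ∃ R : Config E → Config E → Set E,
    ∀ ω ω', R (mix (S ω ω')ᶜ ω ω') (mix (S ω ω') ω ω') = S ω ω'

/-- The original pair is recovered from the swapped pair and `S ω`. -/
theorem mix_mix_compl (S : Set E) (ω ω' : Config E) :
    mix S (mix S ω ω') (mix Sᶜ ω ω') = ω := by
  funext e
  by_cases he : e ∈ S
  · rw [mix_apply_of_mem he, mix_apply_of_mem he]
  · rw [mix_apply_of_notMem he, mix_compl_apply_of_notMem he]

/-- The original second configuration is recovered from the swapped pair and `S ω`. -/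
theorem mix_compl_mix (S : Set E) (ω ω' : Config E) :
    mix S (mix Sᶜ ω ω') (mix S ω ω') = ω' := by
  funext e
  by_cases he : e ∈ S
  · rw [mix_apply_of_mem he, mix_compl_apply_of_mem he]
  · rw [mix_apply_of_notMem he, mix_apply_of_notMem he]

/-- A recoverable swap is injective. -/
theorem swapPair_injective {S : Config E → Config E → Set E} (hS : Recoverable S) :
    Function.Injective (swapPair S) := by
  obtain ⟨R, hR⟩ := hS
  rintro ⟨ω₁, ω₁'⟩ ⟨ω₂, ω₂'⟩ h
  simp only [swapPair, Prod.mk.injEq] at h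
  obtain ⟨h1, h2⟩ := h
  have hT : S ω₁ ω₁' = S ω₂ ω₂' := by
    rw [← hR ω₁ ω₁', h1, h2, hR]
  have e1 : ω₁ = ω₂ := by
    rw [← mix_mix_compl (S ω₁ ω₁') ω₁ ω₁', h1, h2, hT, mix_mix_compl]
  have e2 : ω₁' = ω₂' := by
    rw [← mix_compl_mix (S ω₁ ω₁') ω₁ ω₁', h1, h2, hT, mix_compl_mix]
  rw [e1, e2]

/-- A recoverable swap is a bijection of the (finite) space of pairs of configurations. -/
theorem swapPair_bijective [Fintype E] {S : Config E → Config E → Set E} (hS : Recoverable S) :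
    Function.Bijective (swapPair S) :=
  Finite.injective_iff_bijective.mp (swapPair_injective hS)

variable [Fintype E] [DecidableEq E]

/-- **The swap lemma** (GZ24 Lemma 4.2, finite static form): under a recoverable swap the
swapped pair is distributed like the original pair of independent configurations. -/
theorem sum_swapPair (p : E → ℝ) {S : Config E → Config E → Set E} (hS : Recoverable S)
    (F : Config E → Config E → ℝ) :
    ∑ ω, ∑ ω', weight p ω * weight p ω' * F (mix (S ω ω')ᶜ ω ω') (mix (S ω ω') ω ω') =
      ∑ ω, ∑ ω', weight p ω * weight p ω' * F ω ω' := by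
  have key : ∀ x : Config E × Config E,
      weight p x.1 * weight p x.2 * F (mix (S x.1 x.2)ᶜ x.1 x.2) (mix (S x.1 x.2) x.1 x.2) =
        weight p (swapPair S x).1 * weight p (swapPair S x).2 *
          F (swapPair S x).1 (swapPair S x).2 := by
    intro x
    simp only [swapPair]
    rw [weight_mix_compl_mul_weight_mix]
  rw [← Fintype.sum_prod_type', ← Fintype.sum_prod_type']
  calc ∑ x : Config E × Config E,
        weight p x.1 * weight p x.2 * F (mix (S x.1 x.2)ᶜ x.1 x.2) (mix (S x.1 x.2) x.1 x.2)
      = ∑ x : Config E × Config E,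
          weight p (swapPair S x).1 * weight p (swapPair S x).2 *
            F (swapPair S x).1 (swapPair S x).2 := Finset.sum_congr rfl fun x _ => key x
    _ = ∑ x : Config E × Config E, weight p x.1 * weight p x.2 * F x.1 x.2 :=
        (swapPair_bijective hS).sum_comp fun x => weight p x.1 * weight p x.2 * F x.1 x.2

/-- The product of two probabilities as a sum over pairs of configurations. -/
theorem prob_mul_prob_eq_sum (p : E → ℝ) (X Y : Set (Config E)) :
    prob p X * prob p Y =
      ∑ ω, ∑ ω', weight p ω * weight p ω' * (X.indicator 1 ω * Y.indicator 1 ω') := by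
  unfold prob
  rw [Finset.sum_mul_sum]
  refine Finset.sum_congr rfl fun ω _ => Finset.sum_congr rfl fun ω' _ => ?_
  by_cases hω : ω ∈ X <;> by_cases hω' : ω' ∈ Y <;> simp [hω, hω']

/-- `P(Φ₁ ∈ X ∧ Φ₂ ∈ Y) = P(X) · P(Y)` for a recoverable swap `Φ`. -/
theorem prob_mul_prob_eq_sum_swap (p : E → ℝ) {S : Config E → Config E → Set E}
    (hS : Recoverable S) (X Y : Set (Config E)) :
    prob p X * prob p Y =
      ∑ ω, ∑ ω', weight p ω * weight p ω' *
        (X.indicator 1 (mix (S ω ω')ᶜ ω ω') * Y.indicator 1 (mix (S ω ω') ω ω')) := by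
  rw [prob_mul_prob_eq_sum, sum_swapPair p hS (fun ω ω' => X.indicator 1 ω * Y.indicator 1 ω')]

/-- `P(Φ₂ ∈ Y) = P(Y)` for a recoverable swap `Φ`. -/
theorem sum_indicator_mix_eq_prob (p : E → ℝ) {S : Config E → Config E → Set E}
    (hS : Recoverable S) (Y : Set (Config E)) :
    ∑ ω, ∑ ω', weight p ω * weight p ω' * Y.indicator 1 (mix (S ω ω') ω ω') = prob p Y := by
  have h := sum_swapPair p hS (fun _ ω' => Y.indicator 1 ω')
  rw [h]
  have : ∑ ω, ∑ ω', weight p ω * weight p ω' * Y.indicator 1 ω' =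
      (∑ ω, weight p ω) * ∑ ω', weight p ω' * Y.indicator 1 ω' := by
    rw [Finset.sum_mul]
    refine Finset.sum_congr rfl fun ω _ => ?_
    rw [Finset.mul_sum]
    refine Finset.sum_congr rfl fun ω' _ => by ring
  rw [this, sum_weight, one_mul]
  unfold prob
  refine Finset.sum_congr rfl fun ω' _ => ?_
  by_cases h : ω' ∈ Y <;> simp [h]

end Mix

end PercRepro
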